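import Summits.BirchSwinnertonDyer.BirchSwinnertonDyer.Theses.PrintX6
import Summits.BirchSwinnertonDyer.BirchSwinnertonDyer.Theorems.PrintX6KobayashiUpperHalf
import Summits.BirchSwinnertonDyer.Rank1Residual.Supersingular.X6RankZeroWitness331554a1Vis5LowerHalf
import HarnessLib

/-!
# Route `PrintX6`, leaf A6, residual `EisensteinHalfFiveLeRest`: the Rest cell `(331554a1, p = 5)` CLOSED ON THE ROUTE'S OWN TRUST BASE by a
# SECOND ROAD — `BSD(E,5)` from `PublishedInputsX6` (upper half = the PROVED item `UpperHalfX6`) + `5`-VISIBILITY, WITNESS ROAD, from a NEW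
# `5`-congruent partner on Fisher's Hesse pencil (lower half), and the Rest conclusion at the cell in ROUTE CURRENCY
# (cell `bsd-print-x6`, seat p4 gen 4 — «explicit descent / visibility certificate road»; `--supports` stmt-BirchSwinnertonDyer-21116 as helper; closes no item)

PARTITION currency (D-0054): leaf A6 = X6 ∧ r_an = 0; ONE Rest cell (`E = 331554a1`, `p = 5`; every bad prime split multiplicative, no
erratum prime), already closed per pair by p4-g3's Kim `(t0)`-twin road (`X6RestCellsKimLocalTorsionTrivial*`); this is an INDEPENDENT second road on
classical binders only (Cremona–Mazur visibility + Cassels–Tate; no Kim, no Kato, no Wuthrich Prop. 21). Per pair; BEYOND-PRINT THEOREM: **NO**.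

Composition exactly as `PrintX6Cell12927e1FromInputs.lean` (p553369) at `(12927e1, 7)`: the hW-free LOWER half
`X6RankZero.missingLowerBoundAt_cell_331554a1_at5_vis` (`X6RankZeroWitness331554a1Vis5LowerHalf`: a visible element of `Ш(E)[5]` from ONE witness point of the
NEW `5`-congruent partner `F = [1, 0, 0, -1010480841746109313, 391084101765165656395784201]` — the member `(λ : μ) = (-371 : 1)` of Fisher's direct Hesse pencil of `E`, conductor `N_F = 2607411277002`,
beyond Cremona's table (kit j288450/j289925: the Tate-cluster search of the pencil) — the `5`-congruence PROVED in the kernel on the tree's closed forms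
(modulo Fisher 2012 Thm 13.2), every local kind decided in the kernel, Cassels–Tate) and the route's UPPER half (`X6.missingUpperBoundAt_rankZero_of_thm41`
= item `UpperHalfX6`'s chain). `hϖ` and `hGZK` are conjuncts 4 and 9 of `PublishedInputsX6`, so the binders are exactly: `PublishedInputsX6`, Cassels–Tate,
Tate uniformisation ×2, Fisher 2016 Thm 4.4, Mazur–Rubin 2015 Thm 3.1, Fisher 2012 Thm 13.2, the two minimal models, the newform `f`/`hf`, and the
LEVEL-ONE ENCLOSURE `hball0` of `T₀ = L(E,1)/ω₁ = 25/1` (ty3-g5 kit j287799: PARI `ellL1` + mpmath series/AGM, two engines; this seat's kit j289925 PARI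
re-computation). `ClassX6 W 5` and `r_an = 0` are derived (integer model + point count; enclosure + modularity).
References: [Kobayashi2003] Thm 1.2/4.1; [BDKim2013] Cor 3.15; [CremonaMazur2000] §3; [Fisher2016Visualizing7] Thm 4.4; [Fisher2012Hessian] Thm 13.2;
[MazurRubin2015SelmerCompanions] Thm 3.1; [SilvermanAEC2009] X.4.14; [Miller2011LMS] Def 1.1; HOME/PLAN.md v4.5.
-/

set_option autoImplicit false
set_option linter.dupNamespace false

noncomputable section

open scoped Classical MatrixGroups ModularForm

open CongruenceSubgroup WeierstrassCurve Literature.NumberTheory.EllipticCurves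
  Literature.NumberTheory.EllipticCurves.Rank1Residual
  Literature.NumberTheory.EllipticCurves.Rank1Residual.Typed
  Literature.NumberTheory.EllipticCurves.Fisher2016
  Literature.NumberTheory.EllipticCurves.Fisher2012
  Literature.NumberTheory.EllipticCurves.MazurRubin2015
  Literature.NumberTheory.EllipticCurves.ModularForms
  Summit.BirchSwinnertonDyer.BirchSwinnertonDyer.Rank1Residual.IntModel
  Summit.BirchSwinnertonDyer.Rank1Residual.X11b
  Summit.BirchSwinnertonDyer.Rank1Residual.Supersingular
  Summit.BirchSwinnertonDyer.BirchSwinnertonDyer.Theses.PrintX6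

namespace Summit.BirchSwinnertonDyer.BirchSwinnertonDyer.Theorems.PrintX6

/-- **`BSD(E,5)` for `E = 331554a1` on the route's trust base by `5`-VISIBILITY (second road) — no Kim, no Kato-side binder, no flagged fact.**
Binders: `PublishedInputsX6` (upper half via `X6.missingUpperBoundAt_rankZero_of_thm41`; conjunct 4 = `hϖ`, conjunct 9 = GZK re-used by the lower
half), Cassels–Tate `hCT`, Tate uniformisation `hU`/`hU2`, Fisher 2016 Thm 4.4 `hF44`, Mazur–Rubin `hMR`, Fisher 2012 Thm 13.2 `hF13`, the minimal
models of `E` and of its NEW `5`-congruent partner `F`, the newform `f`/`hf`, the enclosure `hball0` of `T₀ = 25/1`. Lower half: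
`X6RankZero.missingLowerBoundAt_cell_331554a1_at5_vis`; `ClassX6 W 5` from the integer model; `r_an = 0` from the enclosure and modularity (conjunct 8);
then `missingPPartAt_of_lower_of_upper`, `bsdp_of_missingPPartAt`. Per pair; not a class theorem.
[cite: Kobayashi2003, Thm. 4.1 (p. 8) and Thm. 1.2 (p. 2)] [cite: BDKim2013, Cor. 3.15 (p. 199)] [cite: CremonaMazur2000, §3]
[cite: Fisher2016Visualizing7, Thm. 4.4] [cite: Fisher2012Hessian, Thm. 13.2] [cite: MazurRubin2015SelmerCompanions, Thm. 3.1 (iv)(b)]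
[cite: SilvermanAEC2009, Thm. X.4.14] [cite: Miller2011LMS, §1 and Def. 1.1] -/
theorem X6.bsdp_331554a1_at5_vis_of_publishedInputsX6 (hPub : PublishedInputsX6)
    (hCT : exists_casselsTate_pairing (K := ℚ))
    (hU : Silverman1994_thmV53_tateUniformisation.{0})
    (hU2 : Silverman1994_thmV53_corV54_tateUniformisation.{0})
    (hF44 : thm44_selmerLocalKer_iff_of_nonsplit_good) (hMR : selmerLocalKer_iff_of_goodReduction_above)
    (hF13 : thm132_fiveCongruent_hessePencil)
    {W F : WeierstrassCurve ℚ} [W.IsElliptic] [W.IsGloballyMinimal] [F.IsElliptic] [F.IsGloballyMinimal]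
    (hWeq : W = ⟨1, 0, 0, -3453, -78387⟩) (hFeq : F = ⟨1, 0, 0, -1010480841746109313, 391084101765165656395784201⟩)
    {N : ℕ} [NeZero N] (f : CuspForm (Gamma0 N) 2) (hf : IsNewformOf W f)
    (hball0 : ∃ mid rad : ℝ, rad ≤ 1 / 10 ^ (20 : ℕ) ∧ |mid - ((25 : ℤ) : ℝ)| ≤ 1 / 10 ^ (20 : ℕ) ∧
      |((1 : ℕ) : ℝ) * (((2 : ℕ) : ℝ) * ((W.entireLFunction 1).re / plusPeriod f)) - mid| ≤ rad) :
    BSDp W 5 := by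
  haveI : Fact (Nat.Prime 5) := ⟨by norm_num⟩
  obtain ⟨h12, h41, hKim, hϖ, h3, -, hmod, hmod', hGZK⟩ := hPub
  -- the class predicate at 5 from the integer model
  have hIW : integralModelInt W = ⟨1, 0, 0, -3453, -78387⟩ :=
    integralModelInt_eq_of_map_eq _ (by rw [hWeq]; ext <;> simp [WeierstrassCurve.map])
  have hX : ClassX6 W 5 :=
    classX6_of_intModel 5 (by norm_num) hIW (by decide +kernel) (n := 6) card_c331554a1_5 (by decide) (by decide +kernel)
  -- `r_an = 0` from the enclosure
  have hL : W.entireLFunction 1 ≠ 0 := by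
    obtain ⟨mid, rad, hrad, hmid, hball⟩ := hball0
    intro hL0
    rw [hL0] at hball
    simp only [Complex.zero_re, zero_div, mul_zero, zero_sub, abs_neg] at hball
    rw [abs_le] at hmid hball
    norm_num at hmid hball hrad
    linarith [hmid.1, hball.2]
  have hr0 : W.analyticRank = 0 := (W.analyticRank_eq_zero_iff_holds (hmod' W)).2 hL
  -- lower half (5-visibility, witness road + Cassels–Tate, hW-free) and upper half (the route's)
  have hlow : MissingLowerBoundAt W 5 :=
    X6RankZero.missingLowerBoundAt_cell_331554a1_at5_vis hCT hGZK hϖ hU hU2 hF44 hMR hF13 hWeq hFeq f hf hball0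
  exact bsdp_of_missingPPartAt W 5 hGZK (by omega)
    (missingPPartAt_of_lower_of_upper W 5 hlow
      (X6.missingUpperBoundAt_rankZero_of_thm41 W 5 h41 h12 hKim hϖ h3 hmod hmod' hGZK (by norm_num) hX hr0))

/-- **The Rest conclusion AT THE CELL `(331554a1, 5)` in ROUTE CURRENCY by the visibility road** — the T3-witness shape for the residual child
`EisensteinHalfFiveLeRest` (and its parent `EisensteinHalfFiveLe`): `hGZK` and `hϖ` projected out of `PublishedInputsX6` (conjuncts 9 and 4), the
remaining binders verbatim; `∀ q : ℚ, #Ш(E)_an = q → ord₅ q ≠ 0 → ord₅ q ≤ ord₅ #Ш(E/ℚ)`. No Kato-side input (a LOWER bound). Per pair; not a class theorem.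
[cite: CremonaMazur2000, §3] [cite: Fisher2012Hessian, Thm. 13.2] [cite: Fisher2016Visualizing7, Thm. 4.4] [cite: MazurRubin2015SelmerCompanions, Thm. 3.1 (iv)(b)]
[cite: SilvermanAEC2009, Thm. X.4.14] [cite: Miller2011LMS, Def. 1.1] -/
theorem X6.eisensteinHalfFiveLeRest_cell_331554a1_at5_vis_of_publishedInputsX6 (hPub : PublishedInputsX6)
    (hCT : exists_casselsTate_pairing (K := ℚ))
    (hU : Silverman1994_thmV53_tateUniformisation.{0})
    (hU2 : Silverman1994_thmV53_corV54_tateUniformisation.{0})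
    (hF44 : thm44_selmerLocalKer_iff_of_nonsplit_good) (hMR : selmerLocalKer_iff_of_goodReduction_above)
    (hF13 : thm132_fiveCongruent_hessePencil)
    {W F : WeierstrassCurve ℚ} [W.IsElliptic] [W.IsGloballyMinimal] [F.IsElliptic] [F.IsGloballyMinimal]
    (hWeq : W = ⟨1, 0, 0, -3453, -78387⟩) (hFeq : F = ⟨1, 0, 0, -1010480841746109313, 391084101765165656395784201⟩)
    {N : ℕ} [NeZero N] (f : CuspForm (Gamma0 N) 2) (hf : IsNewformOf W f)
    (hball0 : ∃ mid rad : ℝ, rad ≤ 1 / 10 ^ (20 : ℕ) ∧ |mid - ((25 : ℤ) : ℝ)| ≤ 1 / 10 ^ (20 : ℕ) ∧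
      |((1 : ℕ) : ℝ) * (((2 : ℕ) : ℝ) * ((W.entireLFunction 1).re / plusPeriod f)) - mid| ≤ rad) :
    ∀ q : ℚ, shaAn W = (q : ℂ) → padicValRat 5 q ≠ 0 → padicValRat 5 q ≤ (padicValNat 5 W.shaOrder : ℤ) :=
  X6RankZero.eisensteinHalfFiveLeRest_cell_331554a1_at5_vis hCT hPub.2.2.2.2.2.2.2.2 hPub.2.2.2.1 hU hU2 hF44 hMR hF13 hWeq hFeq f hf
    hball0

end Summit.BirchSwinnertonDyer.BirchSwinnertonDyer.Theorems.PrintX6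

end
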